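import Literature.AlgebraicGeometry.Motives.HodgeThetaSubalgebraUnitaryConstantRankLevi
import HarnessLib

/-!
# Constant-rank Levi algebras do not exist, II: rank `2` — an irreducible unitary algebra of type `(a | b)`,
# `3 ≤ a < b`, `b ≥ 5`, has a non-zero raising element of rank `≠ 2`; generic rank along a pencil is COFINITE
# (Ribet 1983 Thm. 3, Lie step — the «inner double Levi» route, second level)

Family `hodge`, layer `Literature/AlgebraicGeometry/Motives` (pure linear algebra over `ℂ`; no geometry). Research
context: cell `pub-hodge-ring2` (HONEST FRAMING: research route conditional on HC_CM; not a corollary; Q11.4-sentence-2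
already refuted in dim ≥ 3), Literature lane gen 86, programme R73. UNCONDITIONAL; theorems only, no definition, no
named fact (D-0026), no `sorry`. Sequel of `HodgeThetaSubalgebraUnitaryConstantRankLevi` (tools A, B).

THE PRINT. K. A. Ribet, Amer. J. Math. 105 (1983), Thm. 3 = Gordon's survey Thm. 6.3 (3) [held
`paper:arxiv-alg-geom_9709030` p. 18]. The lane replaces the classification of minuscule representations pair by pair;
the `r = 6` stall `(9, 20)` (29-folds) leaves the residual profile `(3, 2)` (lit-g85 README §HEIRS), i.e. a large Levi
algebra of type `(6 | 14)` whose non-zero raising elements all have rank `2` — once the profiles `(0, 4)`, `(0, 6)`,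
`(2, 4)` are excluded, which needs the generic-rank lemma in its COFINITE form on two pencils at once.

* §1 **Generic rank is cofinite.** `UnitaryGenericRank.exists_finset_surjective_add_smul`: for `T₀` onto a
  finite-dimensional space, `T + c·T₀` is onto for all `c` outside a finite set (the spectrum of `−T R`, `R` a section
  of `T₀` — verbatim `UnitaryRaisingRank.exists_surjective_add_smul`); hence `rk (T + c·T₀) ≥ rk T₀`
  (`exists_finset_finrank_le_add_smul`) and `rk (T₀ + c·T) ≥ rk T₀` (`exists_finset_finrank_le_add_smul'`, `c ↦ c⁻¹`)
  for cofinitely many `c`, and two such conditions hold for a common `c` (`exists_finrank_le_and_finrank_le`).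
* §2 **`UnitaryConstantRank.exists_raise_rank_ne_two`** — type `(a | b)` with `3 ≤ a < b`, `b ≥ 5`: some non-zero
  raising element has rank `≠ 2` (tool C; tool B of part I is the case `a = 3`). PROOF: otherwise fix a raising `B` of
  rank `2` (maximal) with involution `ι` (`U⁺ = (P ∩ ker C) ⊕ C(P)` of type `(a − 2 | 2)`, `U⁻ = B(W) ⊕ (Q ∩ ker B)` of
  type `(2 | b − 2)`). A raising `X₀` commuting with `ι` and non-zero on `C(P)`
  (`UnitaryLeviFull.exists_raise_commute_apply_ne_zero`) has `(rk X₀|_{U⁺}, rk X₀|_{U⁻}) ∈ {(1, 1), (2, 0)}`. `(1, 1)`: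
  `X₀|_{U⁻}` is a rank-one raising element of the concrete Levi algebra `L⁻` (`UnitaryLeviFull.levi_axioms`), which is
  then full (`UnitaryRankOneRaise.eq_top_of_rankOne_raise_two`), and `UnitaryLeviFull.exists_rankOne_raise_of_full`
  yields a rank-one raising element — contradiction. `(2, 0)`: `L⁻` (irreducible, type `(2 | b − 2)`) has a raising
  element of rank `≥ 2` (`UnitaryThreeCoprime.exists_raise_rank_ge_two`), lifting (`UnitaryLeviLift.exists_raise_restrict`)
  to `X'` with `rk X'|_{U⁻} = 2`, `X'|_{U⁺} = 0`; then `X₀ + X'` has rank `2 + 2 = 4` — contradiction.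

CONSEQUENCE (sequel `HodgeThetaSubalgebraUnitaryNineTwentyCore`): the `(9 | 20)` core; 29-folds of type `(9, 20)`.

## References
* [Ribet1983] K. A. Ribet, *Hodge classes on certain types of abelian varieties*, Amer. J. Math. 105 (1983), Thm. 3.
* [Gordon1997] B. B. Gordon, *A survey of the Hodge conjecture for abelian varieties*, Thm. 6.3 (3), pp. 18–19.
* [Deligne1982HodgeCycles] P. Deligne, *Hodge cycles on abelian varieties*, LNM 900 (1982), I §3 Prop. 3.4, 3.6.
* [GoodmanWallachGTM255] R. Goodman, N. R. Wallach, GTM 255 (2009), §4.1.1.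
* [HoffmanKunze1971LinearAlgebra] K. Hoffman, R. Kunze, *Linear Algebra* (1971), §3.1 Thm. 2, §6.2, §6.7.
-/

noncomputable section

open Module

namespace Literature.AlgebraicGeometry.Motives

namespace HodgeStructure

universe u

variable {W : Type u} [AddCommGroup W] [Module ℂ W]

/-! ### §1 Generic rank along a pencil is cofinite -/

/-- **`T + c·T₀` is onto for all `c` outside a finite set, when `T₀` is** (verbatim the argument of
`UnitaryRaisingRank.exists_surjective_add_smul`: with `R` a section of `T₀`, `(T + cT₀)R = TR + c` is invertible unless
`c` is an eigenvalue of `−TR`). [cite: HoffmanKunze1971LinearAlgebra, §6.2] -/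
theorem UnitaryGenericRank.exists_finset_surjective_add_smul {E F : Type*} [AddCommGroup E] [Module ℂ E]
    [AddCommGroup F] [Module ℂ F] [FiniteDimensional ℂ F] (T₀ T : E →ₗ[ℂ] F) (h₀ : Function.Surjective T₀) :
    ∃ S : Finset ℂ, ∀ c ∉ S, Function.Surjective (T + c • T₀) := by
  classical
  set b := Module.finBasis ℂ F with hbdef
  have hpre : ∀ i, ∃ e, T₀ e = b i := fun i => h₀ (b i)
  choose g hg using hpre
  set R : F →ₗ[ℂ] E := b.constr ℂ g with hRdef
  have hR : ∀ i, T₀ (R (b i)) = b i := fun i => by rw [hRdef, Module.Basis.constr_basis, hg]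
  have hT₀R : T₀ ∘ₗ R = LinearMap.id := b.ext fun i => by rw [LinearMap.comp_apply, hR, LinearMap.id_apply]
  set Fm : Module.End ℂ F := T ∘ₗ R with hFmdef
  refine ⟨(-Fm).finite_hasEigenvalue.toFinset, fun c hc => ?_⟩
  have hc' : ¬ (-Fm).HasEigenvalue c := fun h => hc ((Set.Finite.mem_toFinset _).2 h)
  have hunit : IsUnit (algebraMap ℂ (Module.End ℂ F) c - (-Fm)) := by
    by_contra h
    exact hc' (Module.End.hasEigenvalue_iff_mem_spectrum.2 h)
  have heq : algebraMap ℂ (Module.End ℂ F) c - (-Fm) = (T + c • T₀) ∘ₗ R := by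
    rw [Algebra.algebraMap_eq_smul_one, sub_neg_eq_add, LinearMap.add_comp, LinearMap.smul_comp, hT₀R, add_comm]
    rfl
  have hrange : LinearMap.range ((T + c • T₀) ∘ₗ R) = ⊤ := by
    rw [← heq]; exact (LinearMap.isUnit_iff_range_eq_top _).1 hunit
  intro y
  have hy : y ∈ LinearMap.range ((T + c • T₀) ∘ₗ R) := hrange ▸ Submodule.mem_top
  obtain ⟨x, hx⟩ := hy
  exact ⟨R x, hx⟩

/-- **`rk (T + c·T₀) ≥ rk T₀` for all `c` outside a finite set.** [cite: HoffmanKunze1971LinearAlgebra, §6.2, §3.1 Thm. 2] -/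
theorem UnitaryGenericRank.exists_finset_finrank_le_add_smul {E F : Type*} [AddCommGroup E] [Module ℂ E]
    [AddCommGroup F] [Module ℂ F] [FiniteDimensional ℂ F] (T₀ T : E →ₗ[ℂ] F) :
    ∃ S : Finset ℂ, ∀ c ∉ S,
      Module.finrank ℂ (LinearMap.range T₀) ≤ Module.finrank ℂ (LinearMap.range (T + c • T₀)) := by
  classical
  obtain ⟨π, hπ⟩ := LinearMap.exists_leftInverse_of_injective (LinearMap.range T₀).subtype
    (by rw [Submodule.ker_subtype])
  have hπid : ∀ y : LinearMap.range T₀, π (y : F) = y := fun y => by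
    have h := congrArg (fun f => f y) hπ
    simpa using h
  have hsurj : Function.Surjective (π ∘ₗ T₀) := fun y => by
    obtain ⟨x, hx⟩ := LinearMap.mem_range.1 y.2
    exact ⟨x, by rw [LinearMap.comp_apply, hx, hπid]⟩
  obtain ⟨S, hS⟩ := UnitaryGenericRank.exists_finset_surjective_add_smul (π ∘ₗ T₀) (π ∘ₗ T) hsurj
  refine ⟨S, fun c hc => ?_⟩
  have hc' := hS c hc
  have heq : π ∘ₗ T + c • (π ∘ₗ T₀) = π ∘ₗ (T + c • T₀) := by rw [LinearMap.comp_add, LinearMap.comp_smul]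
  rw [heq] at hc'
  have hrange : LinearMap.range (π ∘ₗ (T + c • T₀)) = ⊤ := LinearMap.range_eq_top.2 hc'
  calc Module.finrank ℂ (LinearMap.range T₀)
      = Module.finrank ℂ (⊤ : Submodule ℂ (LinearMap.range T₀)) := (finrank_top ℂ _).symm
    _ = Module.finrank ℂ (LinearMap.range (π ∘ₗ (T + c • T₀))) := by rw [hrange]
    _ ≤ Module.finrank ℂ (LinearMap.range (T + c • T₀)) := by
        rw [LinearMap.range_comp]; exact Submodule.finrank_map_le _ _

/-- **`rk (T₀ + c·T) ≥ rk T₀` for all `c` outside a finite set** (lower semicontinuity of the rank at `T₀` along the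
pencil; from the previous lemma by `c ↦ c⁻¹`). [cite: HoffmanKunze1971LinearAlgebra, §6.2, §3.1 Thm. 2] -/
theorem UnitaryGenericRank.exists_finset_finrank_le_add_smul' {E F : Type*} [AddCommGroup E] [Module ℂ E]
    [AddCommGroup F] [Module ℂ F] [FiniteDimensional ℂ F] (T₀ T : E →ₗ[ℂ] F) :
    ∃ S : Finset ℂ, ∀ c ∉ S,
      Module.finrank ℂ (LinearMap.range T₀) ≤ Module.finrank ℂ (LinearMap.range (T₀ + c • T)) := by
  classical
  obtain ⟨S, hS⟩ := UnitaryGenericRank.exists_finset_finrank_le_add_smul T₀ T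
  refine ⟨insert 0 (S.image fun c => c⁻¹), fun c hc => ?_⟩
  rw [Finset.mem_insert, not_or] at hc
  obtain ⟨hc0, hcS⟩ := hc
  have hcinv : c⁻¹ ∉ S := fun h => hcS (Finset.mem_image.2 ⟨c⁻¹, h, inv_inv c⟩)
  have h := hS c⁻¹ hcinv
  have heq : T₀ + c • T = c • (T + c⁻¹ • T₀) := by rw [smul_add, smul_smul, mul_inv_cancel₀ hc0, one_smul, add_comm]
  rw [heq, LinearMap.range_smul _ _ hc0]
  exact h

/-- **Two pencils at once:** for a common scalar `c`, `rk (T + c·T₀) ≥ rk T₀` and `rk (T₀' + c·T') ≥ rk T₀'`.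
[cite: HoffmanKunze1971LinearAlgebra, §6.2, §3.1 Thm. 2] -/
theorem UnitaryGenericRank.exists_finrank_le_and_finrank_le {E F E' F' : Type*} [AddCommGroup E] [Module ℂ E]
    [AddCommGroup F] [Module ℂ F] [FiniteDimensional ℂ F] [AddCommGroup E'] [Module ℂ E'] [AddCommGroup F']
    [Module ℂ F'] [FiniteDimensional ℂ F'] (T₀ T : E →ₗ[ℂ] F) (T₀' T' : E' →ₗ[ℂ] F') :
    ∃ c : ℂ, Module.finrank ℂ (LinearMap.range T₀) ≤ Module.finrank ℂ (LinearMap.range (T + c • T₀)) ∧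
      Module.finrank ℂ (LinearMap.range T₀') ≤ Module.finrank ℂ (LinearMap.range (T₀' + c • T')) := by
  classical
  obtain ⟨S, hS⟩ := UnitaryGenericRank.exists_finset_finrank_le_add_smul T₀ T
  obtain ⟨S', hS'⟩ := UnitaryGenericRank.exists_finset_finrank_le_add_smul' T₀' T'
  obtain ⟨c, hc⟩ := Infinite.exists_notMem_finset (S ∪ S')
  rw [Finset.mem_union, not_or] at hc
  exact ⟨c, hS c hc.1, hS' c hc.2⟩

/-! ### §2 Type `(a | b)`, `3 ≤ a < b`, `b ≥ 5`: a non-zero raising element of rank `≠ 2` -/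

/-- **An irreducible unitary algebra of type `(a | b)` with `3 ≤ a < b`, `b ≥ 5` has a non-zero raising element of rank
`≠ 2`.** See the module docstring, §2. [cite: Ribet1983, Thm. 3] [cite: Gordon1997, Thm. 6.3 (3)]
[cite: Deligne1982HodgeCycles, I §3 Prop. 3.4, 3.6] [cite: GoodmanWallachGTM255, §4.1.1] -/
theorem UnitaryConstantRank.exists_raise_rank_ne_two [FiniteDimensional ℂ W] {𝔊 : Submodule ℂ (Module.End ℂ W)}
    (hbr : ∀ Y ∈ 𝔊, ∀ Z ∈ 𝔊, Y * Z - Z * Y ∈ 𝔊)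
    (hirr : ∀ U : Submodule ℂ W, (∀ A ∈ 𝔊, ∀ u ∈ U, A u ∈ U) → U = ⊥ ∨ U = ⊤)
    {Θ : Module.End ℂ W} (hΘ : Θ ∈ 𝔊) (hΘΘ : Θ * Θ = 1)
    {P Q : Submodule ℂ W} (hP : ∀ x, x ∈ P ↔ Θ x = x) (hQ : ∀ x, x ∈ Q ↔ Θ x = -x)
    (hP3 : 3 ≤ Module.finrank ℂ P) (hab : Module.finrank ℂ P < Module.finrank ℂ Q) (hQ5 : 5 ≤ Module.finrank ℂ Q)
    {s : W → W → ℂ} (hadd : ∀ x y z, s (x + y) z = s x z + s y z) (hsymm : ∀ x y, s y x = starRingEnd ℂ (s x y))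
    (hPQ : ∀ p ∈ P, ∀ q ∈ Q, s p q = 0) (hdefP : ∀ p ∈ P, s p p = 0 → p = 0) (hdefQ : ∀ q ∈ Q, s q q = 0 → q = 0)
    (hadj : ∀ X ∈ 𝔊, ∃ Y ∈ 𝔊, ∀ x y, s (X x) y = s x (Y y)) :
    ∃ A ∈ 𝔊, Θ * A = A ∧ A * Θ = -A ∧ A ≠ 0 ∧ Module.finrank ℂ (LinearMap.range A) ≠ 2 := by
  classical
  by_contra hne
  push Not at hne
  have hsU : ∀ U : Submodule ℂ W, ∀ x y z : U, s ((x + y : U) : W) z = s (x : W) z + s (y : W) z :=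
    fun U x y z => by simp only [Submodule.coe_add, hadd]
  have hrk : ∀ B' ∈ 𝔊, Θ * B' = B' → B' * Θ = -B' → Module.finrank ℂ (LinearMap.range B') ≤ 2 := by
    intro B' hB' hΘB' hB'Θ
    by_cases hB'0 : B' = 0
    · rw [hB'0, LinearMap.range_zero, finrank_bot]; omega
    · rw [hne B' hB' hΘB' hB'Θ hB'0]
  -- a raising operator of rank two, of maximal rank; no raising operator of rank one
  obtain ⟨B, hB, hΘB, hBΘ, hr2⟩ :=
    UnitaryThreeCoprime.exists_raise_rank_ge_two hbr hirr hΘ hΘΘ hP hQ (by omega) (by omega)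
  have hBne : B ≠ 0 := fun h => by rw [h, LinearMap.range_zero, finrank_bot] at hr2; omega
  have h2 : Module.finrank ℂ (LinearMap.range B) = 2 := hne B hB hΘB hBΘ hBne
  have hno1 : ∀ B' ∈ 𝔊, Θ * B' = B' → B' * Θ = -B' → Module.finrank ℂ (LinearMap.range B') ≠ 1 := by
    intro B' hB' hΘB' hB'Θ h1
    by_cases hB'0 : B' = 0
    · rw [hB'0, LinearMap.range_zero, finrank_bot] at h1; omega
    · rw [hne B' hB' hΘB' hB'Θ hB'0] at h1; omega
  -- the involution of `B`: `U⁺` of type `(a − 2 | 2)`, `U⁻` of type `(2 | b − 2)`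
  obtain ⟨C, hC, ι, hιmem, hBC, hΘC, hCΘ, hιι, hιΘ, hιs, hιa, hιd, hιb, hιc, hmemA, hmemD, hmemB, hmemC, hfinP₀, hfinQ₀,
    hfinQU, hrangeP, hmapCQ, hfinUm, hfinUp⟩ :=
    UnitaryLeviKernel.exists_involution hbr hΘ hΘΘ hP hQ hadd hsymm hPQ hdefP hdefQ hadj hB hΘB hBΘ
  rw [h2] at hfinP₀ hfinQ₀ hfinQU
  set Um : Submodule ℂ W := LinearMap.ker (ι + 1) with hUmdef
  set Up : Submodule ℂ W := LinearMap.ker (ι - 1) with hUpdef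
  have hUm : ∀ x, x ∈ Um ↔ ι x = -x := fun x => by
    rw [hUmdef, LinearMap.mem_ker, LinearMap.add_apply, Module.End.one_apply, add_eq_zero_iff_eq_neg]
  have hUp : ∀ x, x ∈ Up ↔ ι x = x := fun x => by
    rw [hUpdef, LinearMap.mem_ker, LinearMap.sub_apply, Module.End.one_apply, sub_eq_zero]
  have hcm : ∀ Z : Module.End ℂ W, Z * ι = ι * Z → ∀ x ∈ Um, Z x ∈ Um := fun Z hZ x hx =>
    (hUm _).2 (by rw [← Module.End.mul_apply, ← hZ, Module.End.mul_apply, (hUm x).1 hx, map_neg])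
  have hcp : ∀ Z : Module.End ℂ W, Z * ι = ι * Z → ∀ x ∈ Up, Z x ∈ Up := fun Z hZ x hx =>
    (hUp _).2 (by rw [← Module.End.mul_apply, ← hZ, Module.End.mul_apply, (hUp x).1 hx])
  obtain ⟨Im, Ip, Lm, Lp, -, -, hLm, hLp, -⟩ := UnitaryLeviKernel.exists_kernel_levi 𝔊 hιι hUm hUp
  -- rank bookkeeping for raising operators commuting with `ι`
  have hsplit : ∀ X ∈ 𝔊, Θ * X = X → X * Θ = -X → X * ι = ι * X →
      (X ≠ 0 → Module.finrank ℂ (Up.map X) + Module.finrank ℂ (Um.map X) = 2) ∧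
        Module.finrank ℂ (Up.map X) ≤ 2 ∧ Module.finrank ℂ (Um.map X) ≤ 2 := by
    intro X hX hΘX hXΘ hXc
    have h := UnitaryLeviRank.finrank_range_eq_add hιι hUm hUp hXc
    refine ⟨fun hX0 => by rw [← h]; exact hne X hX hΘX hXΘ hX0, ?_, ?_⟩
    · have hle : Up.map X ≤ P ⊓ LinearMap.ker C := by
        rintro _ ⟨x, hx, rfl⟩
        exact hmemB _ ((hUp _).1 (hcp X hXc x hx)) (by rw [← Module.End.mul_apply, hΘX])
      have h' := hrk X hX hΘX hXΘ
      rw [h] at h'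
      omega
    · have hle : Um.map X ≤ LinearMap.range B := by
        rintro _ ⟨x, hx, rfl⟩
        exact hmemA _ ((hUm _).1 (hcm X hXc x hx)) (by rw [← Module.End.mul_apply, hΘX])
      exact (Submodule.finrank_mono hle).trans (by omega)
  -- the concrete Levi algebra `L⁻` (type `(2 | b − 2)`)
  have hPUle : LinearMap.range B ≤ Um := fun x hx => (hUm x).2 (hιa x hx)
  have hQUle : Q ⊓ LinearMap.ker B ≤ Um := fun d hd => (hUm d).2 (hιd d hd)
  have hPUmem : ∀ x ∈ Um, Θ x = x → x ∈ LinearMap.range B := fun x hx hΘx => hmemA x ((hUm x).1 hx) hΘx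
  have hPUΘ : ∀ x ∈ LinearMap.range B, Θ x = x := fun x hx => (hP x).1 (hrangeP hx)
  have hQUmem : ∀ x ∈ Um, Θ x = -x → x ∈ Q ⊓ LinearMap.ker B := fun x hx hΘx => hmemD x ((hUm x).1 hx) hΘx
  have hQUΘ : ∀ x ∈ Q ⊓ LinearMap.ker B, Θ x = -x := fun x hx => (hQ x).1 (Submodule.mem_inf.1 hx).1
  have hPUQU : ∀ x ∈ LinearMap.range B, ∀ y ∈ Q ⊓ LinearMap.ker B, s x y = 0 := fun x hx y hy =>
    hPQ x (hrangeP hx) y (Submodule.mem_inf.1 hy).1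
  have hdefPU : ∀ x ∈ LinearMap.range B, s x x = 0 → x = 0 := fun x hx h => hdefP x (hrangeP hx) h
  have hdefQU : ∀ y ∈ Q ⊓ LinearMap.ker B, s y y = 0 → y = 0 := fun y hy h =>
    hdefQ y (Submodule.mem_inf.1 hy).1 h
  obtain ⟨ιm, Pm, Qm, hιmapply, hPmmem, hQmmem, hbrLm, hirrLm, hιmmem, hιmιm, hPm, hQm, hfinPm, hfinQm, hPmQm, hdefPm,
    hdefQm, hadjLm, -, -⟩ :=
    UnitaryLeviFull.levi_axioms hbr hirr hΘΘ hP hQ hadd hsymm hPQ hdefP hdefQ hadj hιmem hιι hιs hΘ hΘΘ hιΘ hUm hPUle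
      hQUle hPUmem hPUΘ hQUmem hQUΘ hPUQU hdefPU hdefQU hLm
  rw [h2] at hfinPm
  have hfullm_of : Lm = ⊤ → False := by
    intro hLmtop
    have hfullm : ∀ T : Module.End ℂ Um, ∃ Z ∈ 𝔊, Z * ι = ι * Z ∧ ∀ v : Um, ((T v : Um) : W) = Z v := fun T =>
      (hLm T).1 (by rw [hLmtop]; exact Submodule.mem_top)
    obtain ⟨⟨u, hu⟩, hu0⟩ := Module.finrank_pos_iff_exists_ne_zero.1
      (show 0 < Module.finrank ℂ (LinearMap.range B) by omega)
    have hu0' : u ≠ 0 := fun h => hu0 (Subtype.ext h)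
    obtain ⟨⟨q₀, hq₀⟩, hq₀0⟩ := Module.finrank_pos_iff_exists_ne_zero.1
      (show 0 < Module.finrank ℂ ↥(Q ⊓ LinearMap.ker B) by omega)
    have hq₀0' : q₀ ≠ 0 := fun h => hq₀0 (Subtype.ext h)
    obtain ⟨B₁, hB₁, hΘB₁, hB₁Θ, hr1⟩ := UnitaryLeviFull.exists_rankOne_raise_of_full hbr hΘΘ hιι hιΘ hUm hUp hfullm
      (by omega) (by omega) (hPUΘ u hu) (hιa u hu) hu0' (hQUΘ q₀ hq₀) (hιd q₀ hq₀) hq₀0'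
    exact hno1 B₁ hB₁ hΘB₁ hB₁Θ hr1
  -- a raising `X₀` commuting with `ι`, non-zero on `C(P)`
  have hp0 : ∃ p, p ≠ 0 ∧ ι p = p ∧ Θ p = p := by
    obtain ⟨⟨p, hp⟩, hp0⟩ := Module.finrank_pos_iff_exists_ne_zero.1
      (show 0 < Module.finrank ℂ ↥(P ⊓ LinearMap.ker C) by omega)
    exact ⟨p, fun h => hp0 (Subtype.ext h), hιb p hp, (hP p).1 (Submodule.mem_inf.1 hp).1⟩
  have hq0 : ∃ q, q ≠ 0 ∧ ι q = q ∧ Θ q = -q := by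
    obtain ⟨⟨q, hq⟩, hq0⟩ := Module.finrank_pos_iff_exists_ne_zero.1
      (show 0 < Module.finrank ℂ ↥(P.map C) by omega)
    exact ⟨q, fun h => hq0 (Subtype.ext h), hιc q hq, (hQ q).1 (hmapCQ hq)⟩
  obtain ⟨X₀, hX₀, hΘX₀, hX₀Θ, hX₀c, c, hιc', hΘc, hX₀c0⟩ :=
    UnitaryLeviFull.exists_raise_commute_apply_ne_zero hbr hirr hΘ hΘΘ hQ hιmem hιι hιΘ hUm hUp hp0 hq0
  have hX₀ne : X₀ ≠ 0 := fun h => hX₀c0 (by rw [h, LinearMap.zero_apply])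
  obtain ⟨hX₀2, -, -⟩ := hsplit X₀ hX₀ hΘX₀ hX₀Θ hX₀c
  have hX₀2 := hX₀2 hX₀ne
  have hcUp : c ∈ Up := (hUp c).2 hιc'
  have hX₀Up1 : 1 ≤ Module.finrank ℂ (Up.map X₀) := by
    rw [Nat.one_le_iff_ne_zero, Ne, Submodule.finrank_eq_zero]
    intro h0
    have : X₀ c ∈ Up.map X₀ := Submodule.mem_map_of_mem hcUp
    rw [h0, Submodule.mem_bot] at this
    exact hX₀c0 this
  rcases Nat.lt_or_ge (Module.finrank ℂ (Up.map X₀)) 2 with hlt | hge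
  · -- profile `(1, 1)`: `X₀|_{U⁻}` is a rank-one raising element of `L⁻`, which is then full
    have hX₀Um : Module.finrank ℂ (Um.map X₀) = 1 := by omega
    set x : Module.End ℂ Um := X₀.restrict (hcm X₀ hX₀c) with hxdef
    have hxval : ∀ v : Um, ((x v : Um) : W) = X₀ v := fun v => rfl
    have hxmem : x ∈ Lm := (hLm x).2 ⟨X₀, hX₀, hX₀c, hxval⟩
    have hιmx : ιm * x = x := LinearMap.ext fun v => Subtype.ext (by
      rw [Module.End.mul_apply, hιmapply, hxval, ← Module.End.mul_apply, hΘX₀])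
    have hxιm : x * ιm = -x := LinearMap.ext fun v => Subtype.ext (by
      rw [Module.End.mul_apply, LinearMap.neg_apply, Submodule.coe_neg, hxval, hιmapply, ← Module.End.mul_apply, hX₀Θ,
        LinearMap.neg_apply, hxval])
    have hxrk : Module.finrank ℂ (LinearMap.range x) = 1 := by
      rw [hxdef, UnitaryLeviRank.finrank_range_restrict, hX₀Um]
    exact hfullm_of (UnitaryRankOneRaise.eq_top_of_rankOne_raise_two hbrLm hirrLm hιmmem hιmιm hPm hQm
      (s := fun v w : Um => s (v : W) w) (hsU Um) (fun v w => hsymm v w) hPmQm hdefPm hdefQm hadjLm hxmem hιmx hxιm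
      hxrk hfinPm (by rw [hfinQm]; omega))
  · -- profile `(2, 0)`: `X₀` vanishes on `U⁻`; add a lift of a rank-`≥ 2` raising element of `L⁻`
    have hX₀Um0 : Module.finrank ℂ (Um.map X₀) = 0 := by omega
    have hX₀m : ∀ v ∈ Um, X₀ v = 0 := fun v hv => by
      have h0 : Um.map X₀ = ⊥ := Submodule.finrank_eq_zero.1 hX₀Um0
      have : X₀ v ∈ Um.map X₀ := Submodule.mem_map_of_mem hv
      rwa [h0, Submodule.mem_bot] at this
    obtain ⟨T', hT', hιmT', hT'ιm, hT'2⟩ :=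
      UnitaryThreeCoprime.exists_raise_rank_ge_two hbrLm hirrLm hιmmem hιmιm hPm hQm (by omega) (by omega)
    obtain ⟨Z', hZ', hZ'c, hT'Z'⟩ := (hLm T').1 hT'
    have hZ'1 : ∀ u ∈ Um, Θ (Z' u) = Z' u := fun u hu => by
      have h := congrArg (fun A => ((A ⟨u, hu⟩ : Um) : W)) hιmT'
      simp only [Module.End.mul_apply, hιmapply, hT'Z'] at h
      exact h
    have hZ'2 : ∀ u ∈ Um, Z' (Θ u) = -(Z' u) := fun u hu => by
      have h := congrArg (fun A => ((A ⟨u, hu⟩ : Um) : W)) hT'ιm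
      simp only [Module.End.mul_apply, LinearMap.neg_apply, Submodule.coe_neg, hT'Z'] at h
      rw [hιmapply] at h
      exact h
    obtain ⟨X', hX', hΘX', hX'Θ, hX'c, hX'Z'⟩ := UnitaryLeviLift.exists_raise_restrict hbr hΘ hΘΘ hιΘ hZ' hZ'c hZ'1 hZ'2
    have hx'T' : X'.restrict (hcm X' hX'c) = T' := LinearMap.ext fun v => Subtype.ext (by
      rw [LinearMap.coe_restrict_apply, hX'Z' v v.2, hT'Z' v])
    have hX'Um : 2 ≤ Module.finrank ℂ (Um.map X') := by
      rw [← UnitaryLeviRank.finrank_range_restrict (hcm X' hX'c), hx'T']; exact hT'2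
    have hX'ne : X' ≠ 0 := by
      intro h
      rw [h, Submodule.map_zero, finrank_bot] at hX'Um
      omega
    obtain ⟨hX'2, -, -⟩ := hsplit X' hX' hΘX' hX'Θ hX'c
    have hX'2 := hX'2 hX'ne
    have hX'Up0 : Module.finrank ℂ (Up.map X') = 0 := by omega
    have hX'p : ∀ v ∈ Up, X' v = 0 := fun v hv => by
      have h0 : Up.map X' = ⊥ := Submodule.finrank_eq_zero.1 hX'Up0
      have : X' v ∈ Up.map X' := Submodule.mem_map_of_mem hv
      rwa [h0, Submodule.mem_bot] at this
    set Y : Module.End ℂ W := X₀ + X' with hYdef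
    have hY : Y ∈ 𝔊 := Submodule.add_mem _ hX₀ hX'
    have hΘY : Θ * Y = Y := by rw [hYdef, mul_add, hΘX₀, hΘX']
    have hYΘ : Y * Θ = -Y := by rw [hYdef, add_mul, hX₀Θ, hX'Θ, neg_add]
    have hYc : Y * ι = ι * Y := by rw [hYdef, add_mul, mul_add, hX₀c, hX'c]
    have hYUm : Um.map Y = Um.map X' := by
      apply le_antisymm
      · rintro _ ⟨v, hv, rfl⟩
        exact ⟨v, hv, by rw [hYdef, LinearMap.add_apply, hX₀m v hv, zero_add]⟩
      · rintro _ ⟨v, hv, rfl⟩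
        exact ⟨v, hv, by rw [hYdef, LinearMap.add_apply, hX₀m v hv, zero_add]⟩
    have hYUp : Up.map Y = Up.map X₀ := by
      apply le_antisymm
      · rintro _ ⟨v, hv, rfl⟩
        exact ⟨v, hv, by rw [hYdef, LinearMap.add_apply, hX'p v hv, add_zero]⟩
      · rintro _ ⟨v, hv, rfl⟩
        exact ⟨v, hv, by rw [hYdef, LinearMap.add_apply, hX'p v hv, add_zero]⟩
    obtain ⟨-, hYi, hYj⟩ := hsplit Y hY hΘY hYΘ hYc
    rw [hYUm] at hYj
    rw [hYUp] at hYi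
    have hYne : Y ≠ 0 := by
      intro h
      have : Um.map Y = ⊥ := by rw [h, Submodule.map_zero]
      rw [hYUm] at this
      rw [this, finrank_bot] at hX'Um
      omega
    obtain ⟨hY2, -, -⟩ := hsplit Y hY hΘY hYΘ hYc
    have hY2 := hY2 hYne
    rw [hYUm, hYUp] at hY2
    omega

end HodgeStructure

end Literature.AlgebraicGeometry.Motives
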